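import Summits.QuantumFields.BalabanUV.Beta.LagrangeFold
import Summits.QuantumFields.BalabanUV.Beta.SpineRootedBmNWardRelInv
import Summits.QuantumFields.BalabanUV.Beta.SpineRootedW2

/-!
# `BalabanUV.Beta.LagrangeFoldStep` — binder row D1, (L4) bookkeeping: THE KKT MULTIPLIER-BLOCK IDENTITY `(G∘𝕄_ff∘G)_mm = −G_mm` FOR A
# RELATIVE INVERSE, and the Λ-fold of the wall's step propagators (`BalabanStepW2`'s «ORDER-ONE CONSISTENCY READING», resolvent half)
# (β sub-cell, D1 formalisation swarm, unit `b2b-balaban-beta-d1-formalise-leaf-10`, gen 2; CLAIM «D1-L4-FOLD», part 2)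

NOT IN PRINT; OUR BOOKKEEPING.  HONEST FRAMING (cell contract, verbatim): «discharging `BetaPertH` makes Bałaban's UV stability
UNCONDITIONAL — a real constructive-QFT result; it is NOT the continuum limit and NOT the Clay problem.»  HONEST DEPENDENCY (verbatim):
«continuum YM on T⁴ ⇐ BetaPertH ∧ nine spine estimates (0/9 proved); BetaPertH ⇐ (D1) ∧ (D4) ∧ CAP+tail; G-an2-4 gates asym, D1 and
NE2/3/4.»  This module is [folklore] kernel algebra; it instantiates NO binder of the β-function wall, carries no `[cite:]` tag, no `def`,
no `def … : Prop`, and is NOT D1, NOT `BetaPertH`, NOT continuum, NOT Clay.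

## What

* §1 **`mm_sandwich_eq_neg`** — for kernels `G`, `𝕄`, `H` on the packed fibre with `RelInv G 𝕄 (axEc ρ N)` (an5/an2's four relative
  rules, `ChartConjugationRelative.RelInv`, IN TREE for the wall's `G_j` against `bhKStepAt j`: `SpineRootedBmNWardRelInv`), `G` decaying,
  `𝕄` bounded with ZERO multiplier block, and `H` = the field block of `𝕄` (all other blocks zero):
  `(G∘H∘G)(x, z)(inr m, inr m′) = −G(x, z)(inr m, inr m′)`.
  Block algebra: `(G∘H)_{mf} = (G∘𝕄)_{mf} − G_{mm}∘𝕄_{mf}`; the first term dies against `G_{fm}` because `G`'s field rows vanish on comb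
  bonds (`axEc∘G = G`) while `(G∘𝕄)∘axEc = axEc` kills `(G∘𝕄)_{mf}` off them; the second gives `−G_{mm}∘(𝕄∘G)_{mm} = −G_{mm}∘axEc_{mm} = −G_{mm}`
  (`(axEc∘𝕄)∘G = axEc`, `G∘axEc = G`).  One Fubini (`KernelWard.tsum_comm_of_prodBound`).
* §2 THE WALL: for `G_{j+1} := coDressKBmAt (toSite r) Lc (KInvStep Lc (j+1))` (in-block root `r`), whose step operator `bhKStepAt (j+1)` has
  field block `wVH (j+1) • E2 (j+1)` (`BorderedHessianStep.bhKStepAt_succ_inl_inl`, rfl) and zero multiplier block: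
  `colM_sandwich_E2` — `colM (G∘E2 (j+1)∘G) Lc μ y ρ′ w = −(wVH (j+1))⁻¹ · colM G Lc μ y ρ′ w`; `vertexOfM_sandwich_E2`; and with part 1
  (`LagrangeFold.vertexOfK_smul_SLam_lamCoeffK`) **`vertexOfK_lagrangePiece_eq_vertexOfM`**:
  `vertexOfK G Lc (κ u ↦ c • SLam Lc (lamCoeffK G (E2 (j+1)) Lc) Q κ u) μ y = (c / wVH (j+1)) • vertexOfM G Lc Q μ y`
  for every bounded coarse-bond table `Q` — the Λ-FOLDED first-order piece, typed THROUGH `G_{j+1}`, IS the multiplier-column vertex with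
  weight `c / wVH (j+1)` and a PLUS sign; since `wΛ (j+1) = wM1 (j+1) · wVH (j+1)` (`wΛ_eq_wM1_mul_wVH`, `ring`), the Lagrange piece
  `(cΛ·wΛ) • SLam …` of the recursive tables folds to EXACTLY an2's `M1At ρ cΛ (j+1) = (cΛ·wM1) • hessFFAt` (`vertexOfK_lagrangePiece_eq_M1At`).

NOT CLAIMED: the same for the CURRENT typing of `WardLocusRecursive.SrecAt` (conversion coefficients through the STRAIGHT `KInvStep Lc j`
while the vertex reads the co-dressed `G_j` — the mixed sandwich `KInvStep_j∘E2_j∘G_j`; an2's OPEN TYPING POINT (Λ-slot)); level `0`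
(`S0NAt` uses `BalabanStepJets.lamCoeffOf (KInv Lc)` with the finite-range Wilson-Hessian column, and `bhKAt`'s field block is the windowed
`d*d` — a separate bridge); anything about (W-L4)'s table laws.
-/

noncomputable section

open Finset
open scoped BigOperators
open Literature.MathematicalPhysics.QuantumFieldTheory
open Literature.MathematicalPhysics.QuantumFieldTheory.Balaban1983to89
open Literature.MathematicalPhysics.QuantumFieldTheory.Balaban1983to89.Beta
open B12Sec2to5 (l1 l1_nonneg)
open ExpKernelCalculus (MKer Decays comp summable_exp_shift summable_exp_shift')
open KernelWard (ProdBound tsum_comm_of_prodBound bdd_of_decays)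
open AffineAveraging (box toSite)
open OneStepResolventKernel (Fib decays_mono)
open OneStepKernelFamily (KInvStep colH vertexOfK)
open InterLevelTransport (SLam cwsum cwsum_apply)
open BalabanStepJetsSucc (lamCoeffK E2 wVH wΛ decays_E2 decays_comp)
open BalabanStepW2 (wM1)
open SecondOrderResponse (colM vertexOfM)
open Summit.QuantumFields.BalabanUV.Beta.TameKernelCalculus
open Summit.QuantumFields.BalabanUV.Beta.ChartConjugationRelative (RelInv)
open Literature.Probability.LatticeModels (Torus.proj)
open AveragingHessianKernelsRooted (hessFFAt)
open Summit.QuantumFields.BalabanUV.Beta.AxialDressingRooted (IsCombBondAt axEc axEc_inr_inr comp_axEc_apply comp_axEc_apply'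
  coDressKBmAt decays_coDressKBmAt_KInvStep)
open Summit.QuantumFields.BalabanUV.Beta.BorderedHessian (bhKStepAt bhKStepAt_succ_inl_inl spr_bhKStepAt)
open Summit.QuantumFields.BalabanUV.Beta.SpineRooted (M1At relInv_coDressKBmAt_KInvStep_bhKStepAt_all)
open Summit.QuantumFields.BalabanUV.Beta.LagrangeFold (comp_inr_col_eq_zero E2_inr_col vertexOfK_smul_SLam_lamCoeffK)

namespace Summit.QuantumFields.BalabanUV.Beta.LagrangeFoldStep

variable {d : ℕ} {N : ℕ}

/-! ## §1 The KKT multiplier-block identity for a relative inverse -/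

section KKT

variable {ρ : Fin (d + 1) → ℤ} {G M H : MKer (d + 1) (Fib d)}

/-- [folklore] A decaying row times a bounded sequence is summable. -/
theorem summable_row_mul {C δ : ℝ} (hG : Decays G C δ) (hδ : 0 < δ) (x : Fin (d + 1) → ℤ) (a f : Fib d)
    {X : (Fin (d + 1) → ℤ) → ℝ} {B : ℝ} (hX : ∀ u, |X u| ≤ B) : Summable fun u => G x u a f * X u := by
  refine Summable.of_norm_bounded ((summable_exp_shift hδ x).mul_left (C * |B|)) (fun u => ?_)
  rw [Real.norm_eq_abs, abs_mul]
  calc |G x u a f| * |X u| ≤ (C * Real.exp (-δ * l1 (x - u))) * |B| :=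
        mul_le_mul (hG x u a f) ((hX u).trans (le_abs_self B)) (abs_nonneg _) ((abs_nonneg _).trans (hG x u a f))
    _ = C * |B| * Real.exp (-δ * l1 (x - u)) := by ring

/-- [folklore] A bounded sequence times a decaying column is summable. -/
theorem summable_mul_col {C δ : ℝ} (hG : Decays G C δ) (hδ : 0 < δ) (z : Fin (d + 1) → ℤ) (f b : Fib d)
    {X : (Fin (d + 1) → ℤ) → ℝ} {B : ℝ} (hX : ∀ v, |X v| ≤ B) : Summable fun v => X v * G v z f b := by
  refine Summable.of_norm_bounded ((summable_exp_shift' hδ z).mul_left (C * |B|)) (fun v => ?_)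
  rw [Real.norm_eq_abs, abs_mul]
  calc |X v| * |G v z f b| ≤ |B| * (C * Real.exp (-δ * l1 (v - z))) :=
        mul_le_mul ((hX v).trans (le_abs_self B)) (hG v z f b) (abs_nonneg _) (abs_nonneg _)
    _ = C * |B| * Real.exp (-δ * l1 (v - z)) := by ring

/-- [folklore] Step (a): for `H` = the field block of `𝕄`, `(G∘H)(x,v)(inr m, inl l) = Σ'_u Σ_κ G(x,u)(inr m, inl κ)·𝕄(u,v)(inl κ, inl l)`. -/
theorem GH_mf (hHff : ∀ x z κ l, H x z (Sum.inl κ) (Sum.inl l) = M x z (Sum.inl κ) (Sum.inl l))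
    (hHmf : ∀ x z ν l, H x z (Sum.inr ν) (Sum.inl l) = 0) (x v : Fin (d + 1) → ℤ) (m l : Fin (d + 1)) :
    comp G H x v (Sum.inr m) (Sum.inl l) = ∑' u, ∑ κ : Fin (d + 1), G x u (Sum.inr m) (Sum.inl κ) * M u v (Sum.inl κ) (Sum.inl l) := by
  unfold ExpKernelCalculus.comp
  refine tsum_congr fun u => ?_
  rw [Fintype.sum_sum_type]
  simp only [hHff, hHmf, mul_zero, Finset.sum_const_zero, add_zero]

/-- [folklore] Step (b): `(G∘𝕄)(x,v)(inr m, inl l)` splits into its field-leg and multiplier-leg parts (both summable). -/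
theorem GM_mf_split (hG : ∃ δ C : ℝ, 0 < δ ∧ 0 ≤ C ∧ Decays G C δ) (hM : ∃ B : ℝ, ∀ x z a b, |M x z a b| ≤ B)
    (x v : Fin (d + 1) → ℤ) (m l : Fin (d + 1)) :
    comp G M x v (Sum.inr m) (Sum.inl l) =
      (∑' u, ∑ κ : Fin (d + 1), G x u (Sum.inr m) (Sum.inl κ) * M u v (Sum.inl κ) (Sum.inl l)) +
        ∑' u, ∑ ν : Fin (d + 1), G x u (Sum.inr m) (Sum.inr ν) * M u v (Sum.inr ν) (Sum.inl l) := by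
  obtain ⟨δ, C, hδ, _, hGd⟩ := hG
  obtain ⟨B, hB⟩ := hM
  unfold ExpKernelCalculus.comp
  rw [← Summable.tsum_add (summable_sum fun κ _ => summable_row_mul hGd hδ x _ _ (fun u => hB u v _ _))
    (summable_sum fun ν _ => summable_row_mul hGd hδ x _ _ (fun u => hB u v _ _))]
  exact tsum_congr fun u => Fintype.sum_sum_type _

/-- [folklore] Step (c): `(G∘𝕄)(x,v)(inr m, inl l) · G(v,z)(inl l, inr m′) = 0` — `G`'s field rows vanish on comb bonds (`axEc∘G = G`) and
`(G∘𝕄)∘axEc = axEc` kills `(G∘𝕄)_{mf}` off them. -/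
theorem GM_mf_mul_G_fm (hrel : RelInv G M (axEc ρ N)) (x v z : Fin (d + 1) → ℤ) (m l m' : Fin (d + 1)) :
    comp G M x v (Sum.inr m) (Sum.inl l) * G v z (Sum.inl l) (Sum.inr m') = 0 := by
  by_cases hc : IsCombBondAt ρ N l v
  · have h := congrFun (congrFun (congrFun (congrFun hrel.EA v) z) (Sum.inl l)) (Sum.inr m')
    rw [comp_axEc_apply] at h
    simp only [hc, if_true] at h
    rw [← h, mul_zero]
  · have h := congrFun (congrFun (congrFun (congrFun hrel.AME x) v) (Sum.inr m)) (Sum.inl l)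
    rw [comp_axEc_apply'] at h
    simp only [hc, if_false] at h
    rw [h, show axEc ρ N x v (Sum.inr m) (Sum.inl l) = 0 from rfl, zero_mul]

/-- [folklore] Step (d): for `𝕄` with zero multiplier block, `(𝕄∘G)(u,z)(inr ν, inr m′) = Σ'_v Σ_l 𝕄(u,v)(inr ν, inl l)·G(v,z)(inl l, inr m′)`. -/
theorem MG_mm (hMmm : ∀ x z ν ν', M x z (Sum.inr ν) (Sum.inr ν') = 0) (u z : Fin (d + 1) → ℤ) (ν m' : Fin (d + 1)) :
    comp M G u z (Sum.inr ν) (Sum.inr m') = ∑' v, ∑ l : Fin (d + 1), M u v (Sum.inr ν) (Sum.inl l) * G v z (Sum.inl l) (Sum.inr m') := by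
  unfold ExpKernelCalculus.comp
  refine tsum_congr fun v => ?_
  rw [Fintype.sum_sum_type]
  simp only [hMmm, zero_mul, Finset.sum_const_zero, add_zero]

/-- [folklore] Step (e): `(axEc∘𝕄)∘G = axEc` read on the multiplier block: `[proj N u = 0]·(𝕄∘G)(u,z)(inr ν, inr m′) = axEc(u,z)(inr ν, inr m′)`. -/
theorem PMG_mm (hrel : RelInv G M (axEc ρ N)) (u z : Fin (d + 1) → ℤ) (ν m' : Fin (d + 1)) :
    (if Torus.proj N u = 0 then comp M G u z (Sum.inr ν) (Sum.inr m') else 0) = axEc ρ N u z (Sum.inr ν) (Sum.inr m') := by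
  have h := congrFun (congrFun (congrFun (congrFun hrel.EMA u) z) (Sum.inr ν)) (Sum.inr m')
  rw [← h]
  rw [show comp (comp (axEc ρ N) M) G u z (Sum.inr ν) (Sum.inr m') =
      ∑' v, ∑ g : Fib d, comp (axEc ρ N) M u v (Sum.inr ν) g * G v z g (Sum.inr m') from rfl]
  simp only [comp_axEc_apply]
  split_ifs with hp
  · rfl
  · simp only [zero_mul, Finset.sum_const_zero, tsum_zero]

/-- [folklore] Step (f): `G∘axEc = G` read on the multiplier block: `G(x,u)(inr m, inr ν) = [proj N u = 0]·G(x,u)(inr m, inr ν)`. -/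
theorem G_mm_eq (hrel : RelInv G M (axEc ρ N)) (x u : Fin (d + 1) → ℤ) (m ν : Fin (d + 1)) :
    G x u (Sum.inr m) (Sum.inr ν) = if Torus.proj N u = 0 then G x u (Sum.inr m) (Sum.inr ν) else 0 := by
  have h := congrFun (congrFun (congrFun (congrFun hrel.AE x) u) (Sum.inr m)) (Sum.inr ν)
  rw [comp_axEc_apply'] at h
  exact h.symm

/-- [folklore] Step (g): `Σ'_u Σ_ν G(x,u)(inr m, inr ν)·(𝕄∘G)(u,z)(inr ν, inr m′) = G(x,z)(inr m, inr m′)`. -/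
theorem sum_G_mm_MG_mm (hrel : RelInv G M (axEc ρ N)) (x z : Fin (d + 1) → ℤ) (m m' : Fin (d + 1)) :
    ∑' u, ∑ ν : Fin (d + 1), G x u (Sum.inr m) (Sum.inr ν) * comp M G u z (Sum.inr ν) (Sum.inr m') = G x z (Sum.inr m) (Sum.inr m') := by
  have e : ∀ u ν, G x u (Sum.inr m) (Sum.inr ν) * comp M G u z (Sum.inr ν) (Sum.inr m')
      = G x u (Sum.inr m) (Sum.inr ν) * (if u = z ∧ ν = m' ∧ Torus.proj N u = 0 then 1 else 0) := by
    intro u ν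
    rw [← axEc_inr_inr, ← PMG_mm hrel u z ν m']
    by_cases hp : Torus.proj N u = 0
    · simp only [hp, if_true]
    · have hg := G_mm_eq hrel x u m ν
      simp only [hp, if_false] at hg ⊢
      rw [hg, zero_mul, mul_zero]
  simp only [e]
  rw [tsum_eq_single z (fun u hu => Finset.sum_eq_zero fun ν _ => by simp only [hu, false_and, if_false, mul_zero])]
  rw [Finset.sum_eq_single m' (fun ν _ hν => by simp only [hν, false_and, and_false, if_false, mul_zero])
    (fun h => absurd (Finset.mem_univ m') h)]
  rw [G_mm_eq hrel x z m m']
  by_cases hp : Torus.proj N z = 0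
  · simp only [hp, and_self, if_true, mul_one]
  · simp only [hp, and_false, if_false, mul_zero]

/-- [folklore] **THE KKT MULTIPLIER-BLOCK IDENTITY FOR A RELATIVE INVERSE.**  For `RelInv G 𝕄 (axEc ρ N)`, `G` decaying, `𝕄` bounded
with zero multiplier block, and `H` the field block of `𝕄`: `(G∘H∘G)(x,z)(inr m, inr m′) = −G(x,z)(inr m, inr m′)`. -/
theorem mm_sandwich_eq_neg (hrel : RelInv G M (axEc ρ N)) (hG : ∃ δ C : ℝ, 0 < δ ∧ 0 ≤ C ∧ Decays G C δ)
    (hM : ∃ B : ℝ, ∀ x z a b, |M x z a b| ≤ B) (hMmm : ∀ x z ν ν', M x z (Sum.inr ν) (Sum.inr ν') = 0)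
    (hHff : ∀ x z κ l, H x z (Sum.inl κ) (Sum.inl l) = M x z (Sum.inl κ) (Sum.inl l))
    (hHfm : ∀ x z κ ν, H x z (Sum.inl κ) (Sum.inr ν) = 0) (hHmf : ∀ x z ν l, H x z (Sum.inr ν) (Sum.inl l) = 0)
    (hHmm : ∀ x z ν ν', H x z (Sum.inr ν) (Sum.inr ν') = 0) (x z : Fin (d + 1) → ℤ) (m m' : Fin (d + 1)) :
    comp (comp G H) G x z (Sum.inr m) (Sum.inr m') = -G x z (Sum.inr m) (Sum.inr m') := by
  obtain ⟨δ, C, hδ, hC, hGd⟩ := hG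
  obtain ⟨B, hB⟩ := hM
  have hHcol : ∀ v u (h : Fib d) (ν : Fin (d + 1)), H v u h (Sum.inr ν) = 0 := fun v u h ν => by
    cases h with
    | inl κ => exact hHfm v u κ ν
    | inr ν' => exact hHmm v u ν' ν
  -- the remainder R(v, l) := Σ'_u Σ_ν G(x,u)(inr m, inr ν)·𝕄(u,v)(inr ν, inl l)
  set R : (Fin (d + 1) → ℤ) → Fin (d + 1) → ℝ :=
    fun v l => ∑' u, ∑ ν : Fin (d + 1), G x u (Sum.inr m) (Sum.inr ν) * M u v (Sum.inr ν) (Sum.inl l) with hR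
  -- (GH)_mf · G_fm = −R · G_fm
  have hGH : ∀ v l, comp G H x v (Sum.inr m) (Sum.inl l) * G v z (Sum.inl l) (Sum.inr m') = -(R v l * G v z (Sum.inl l) (Sum.inr m')) := by
    intro v l
    have h1 : comp G H x v (Sum.inr m) (Sum.inl l) = comp G M x v (Sum.inr m) (Sum.inl l) - R v l := by
      rw [GH_mf hHff hHmf, GM_mf_split ⟨δ, C, hδ, hC, hGd⟩ ⟨B, hB⟩, hR]
      ring
    rw [h1, sub_mul, GM_mf_mul_G_fm hrel, zero_sub]
  -- bounds
  have hBabs : ∀ x z a b, |M x z a b| ≤ |B| := fun x z a b => (hB x z a b).trans (le_abs_self B)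
  have hGb : ∀ x z a b, |G x z a b| ≤ C := fun x z a b => bdd_of_decays hGd hδ.le x z a b
  -- the double family F(u, v) := Σ_ν Σ_l G(x,u)(m,ν) 𝕄(u,v)(ν,l) G(v,z)(l,m')
  set F : (Fin (d + 1) → ℤ) → (Fin (d + 1) → ℤ) → ℝ := fun u v =>
    ∑ ν : Fin (d + 1), ∑ l : Fin (d + 1), G x u (Sum.inr m) (Sum.inr ν) * M u v (Sum.inr ν) (Sum.inl l) * G v z (Sum.inl l) (Sum.inr m')
    with hF
  have hPB : ProdBound F := by
    refine ⟨fun u => ((d + 1 : ℕ) * ((d + 1 : ℕ) * (C * |B| * C))) * Real.exp (-δ * l1 (x - u)),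
      fun v => Real.exp (-δ * l1 (v - z)), (summable_exp_shift hδ x).mul_left _, summable_exp_shift' hδ z,
      fun u => by positivity, fun v => (Real.exp_pos _).le, fun u v => ?_⟩
    calc |F u v| ≤ ∑ ν : Fin (d + 1), |∑ l : Fin (d + 1), G x u (Sum.inr m) (Sum.inr ν) * M u v (Sum.inr ν) (Sum.inl l)
            * G v z (Sum.inl l) (Sum.inr m')| := Finset.abs_sum_le_sum_abs _ _
      _ ≤ ∑ _ν : Fin (d + 1), ∑ _l : Fin (d + 1), (C * Real.exp (-δ * l1 (x - u))) * |B| * (C * Real.exp (-δ * l1 (v - z))) := by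
          refine Finset.sum_le_sum fun ν _ => (Finset.abs_sum_le_sum_abs _ _).trans (Finset.sum_le_sum fun l _ => ?_)
          rw [abs_mul, abs_mul]
          exact mul_le_mul (mul_le_mul (hGd x u _ _) (hBabs u v _ _) (abs_nonneg _)
              ((abs_nonneg _).trans (hGd x u (Sum.inr m) (Sum.inr ν))))
            (hGd v z _ _) (abs_nonneg _) (by positivity)
      _ = _ := by simp only [Finset.sum_const, Finset.card_univ, Fintype.card_fin, nsmul_eq_mul]; ring
  obtain ⟨_, hF1, hF2⟩ := hPB.summable
  -- summability of the pieces
  have hsR : ∀ v l, Summable fun u => ∑ ν : Fin (d + 1), G x u (Sum.inr m) (Sum.inr ν) * M u v (Sum.inr ν) (Sum.inl l) :=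
    fun v l => summable_sum fun ν _ => summable_row_mul hGd hδ x _ _ (fun u => hB u v _ _)
  have hsMG : ∀ u ν, Summable fun v => ∑ l : Fin (d + 1), M u v (Sum.inr ν) (Sum.inl l) * G v z (Sum.inl l) (Sum.inr m') :=
    fun u ν => summable_sum fun l _ => summable_mul_col hGd hδ z _ _ (fun v => hB u v _ _)
  -- main computation
  rw [show comp (comp G H) G x z (Sum.inr m) (Sum.inr m') = ∑' v, ∑ g : Fib d, comp G H x v (Sum.inr m) g * G v z g (Sum.inr m') from rfl]
  have e1 : ∀ v, ∑ g : Fib d, comp G H x v (Sum.inr m) g * G v z g (Sum.inr m') = -∑' u, F u v := by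
    intro v
    rw [Fintype.sum_sum_type]
    simp only [comp_inr_col_eq_zero hHcol, zero_mul, Finset.sum_const_zero, add_zero, hGH, Finset.sum_neg_distrib]
    refine congrArg Neg.neg ?_
    -- Σ_l R v l * G(v,z)(l,m') = Σ'_u F u v
    have e2 : ∀ l, R v l * G v z (Sum.inl l) (Sum.inr m')
        = ∑' u, ∑ ν : Fin (d + 1), G x u (Sum.inr m) (Sum.inr ν) * M u v (Sum.inr ν) (Sum.inl l) * G v z (Sum.inl l) (Sum.inr m') := by
      intro l
      rw [hR, ← tsum_mul_right]
      exact tsum_congr fun u => Finset.sum_mul _ _ _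
    simp only [e2]
    rw [← Summable.tsum_finsetSum (fun l _ => (hsR v l).mul_right _ |>.congr (fun u => Finset.sum_mul _ _ _))]
    exact tsum_congr fun u => Finset.sum_comm
  simp only [e1, tsum_neg]
  rw [← tsum_comm_of_prodBound hPB]
  -- Σ'_u Σ'_v F u v = Σ'_u Σ_ν G(x,u)(m,ν) (𝕄G)(u,z)(ν,m')
  have e3 : ∀ u, ∑' v, F u v = ∑ ν : Fin (d + 1), G x u (Sum.inr m) (Sum.inr ν) * comp M G u z (Sum.inr ν) (Sum.inr m') := by
    intro u
    have e4 : ∀ v, F u v = ∑ ν : Fin (d + 1), G x u (Sum.inr m) (Sum.inr ν) *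
        ∑ l : Fin (d + 1), M u v (Sum.inr ν) (Sum.inl l) * G v z (Sum.inl l) (Sum.inr m') := by
      intro v
      simp only [hF, Finset.mul_sum]
      exact Finset.sum_congr rfl fun ν _ => Finset.sum_congr rfl fun l _ => by ring
    simp only [e4]
    rw [Summable.tsum_finsetSum (fun ν _ => (hsMG u ν).mul_left _)]
    refine Finset.sum_congr rfl fun ν _ => ?_
    rw [tsum_mul_left, MG_mm hMmm]
  simp only [e3]
  rw [sum_G_mm_MG_mm hrel]

end KKT

/-! ## §2 The wall's step propagators: the Λ-fold through `G_{j+1}` is the multiplier-column vertex -/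

section Wall

variable {Lc : ℕ} [NeZero Lc] {r : Fin (d + 1) → ℕ}

omit [NeZero Lc] in
/-- [folklore] The weights: `wΛ j = wM1 j · wVH j` (exponents `4 = 2 + 2` in units of `(d+2)`). -/
theorem wΛ_eq_wM1_mul_wVH (j : ℕ) : wΛ d Lc j = wM1 d Lc j * wVH d Lc j := by
  simp only [wΛ, wM1, wVH, ← pow_add]
  ring_nf

/-- [folklore] `wVH d Lc j ≠ 0`. -/
theorem wVH_ne_zero (j : ℕ) : wVH d Lc j ≠ 0 := by
  simp only [wVH]
  exact pow_ne_zero _ (pow_ne_zero _ (by exact_mod_cast NeZero.ne Lc))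

/-- [folklore] **THE MULTIPLIER COLUMN OF THE SANDWICH `G∘E2∘G` FOR THE WALL'S STEP PROPAGATOR** `G = G_{j+1}`:
`colM (G∘E2 (j+1)∘G) Lc μ y ρ′ w = −(wVH (j+1))⁻¹ · colM G Lc μ y ρ′ w` (§1 with `𝕄 := bhKStepAt (j+1)`, `H := wVH (j+1) • E2 (j+1)`). -/
theorem colM_sandwich_E2 (hr : r ∈ box (d + 1) Lc) (j : ℕ) (μ : Fin (d + 1)) (y : Fin (d + 1) → ℤ) (ρ' : Fin (d + 1))
    (w : Fin (d + 1) → ℤ) :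
    colM (comp (comp (coDressKBmAt (toSite r) Lc (KInvStep (d := d) Lc (j + 1))) (E2 d Lc (j + 1)))
        (coDressKBmAt (toSite r) Lc (KInvStep (d := d) Lc (j + 1)))) Lc μ y ρ' w
      = -(wVH d Lc (j + 1))⁻¹ * colM (coDressKBmAt (toSite r) Lc (KInvStep (d := d) Lc (j + 1))) Lc μ y ρ' w := by
  set G := coDressKBmAt (toSite r) Lc (KInvStep (d := d) Lc (j + 1)) with hGdef
  set H : MKer (d + 1) (Fib d) := fun x z a b => wVH d Lc (j + 1) * E2 d Lc (j + 1) x z a b with hH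
  have hw : wVH d Lc (j + 1) ≠ 0 := wVH_ne_zero (j + 1)
  obtain ⟨CM, δM, hδM, hMd⟩ := spr_bhKStepAt (d := d) hr (j + 1)
  have hkkt := mm_sandwich_eq_neg (G := G) (M := bhKStepAt d (toSite r) Lc (j + 1)) (H := H)
    (relInv_coDressKBmAt_KInvStep_bhKStepAt_all hr (j + 1)) (decays_coDressKBmAt_KInvStep hr (j + 1))
    ⟨CM, fun x z a b => bdd_of_decays hMd hδM.le x z a b⟩ (fun x z ν ν' => rfl)
    (fun x z κ l => by rw [hH, bhKStepAt_succ_inl_inl]) (fun x z κ ν => by simp only [hH, E2_inr_col, mul_zero])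
    (fun x z ν l => by simp only [hH]; exact mul_eq_zero_of_right _ rfl) (fun x z ν ν' => by simp only [hH, E2_inr_col, mul_zero])
    ((Lc : ℤ) • w) ((Lc : ℤ) • y) ρ' μ
  -- comp (comp G H) G = wVH • comp (comp G E2) G, entrywise
  have hlin : comp (comp G H) G ((Lc : ℤ) • w) ((Lc : ℤ) • y) (Sum.inr ρ') (Sum.inr μ)
      = wVH d Lc (j + 1) * comp (comp G (E2 d Lc (j + 1))) G ((Lc : ℤ) • w) ((Lc : ℤ) • y) (Sum.inr ρ') (Sum.inr μ) := by
    have hGH : comp G H = fun x z a b => wVH d Lc (j + 1) * comp G (E2 d Lc (j + 1)) x z a b := by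
      funext x z a b
      simp only [ExpKernelCalculus.comp, hH, ← tsum_mul_left, Finset.mul_sum]
      exact tsum_congr fun u => Finset.sum_congr rfl fun f _ => by ring
    rw [hGH]
    rw [show comp (fun x z a b => wVH d Lc (j + 1) * comp G (E2 d Lc (j + 1)) x z a b) G ((Lc : ℤ) • w) ((Lc : ℤ) • y) (Sum.inr ρ') (Sum.inr μ)
        = ∑' v, ∑ g : Fib d, (wVH d Lc (j + 1) * comp G (E2 d Lc (j + 1)) ((Lc : ℤ) • w) v (Sum.inr ρ') g) * G v ((Lc : ℤ) • y) g (Sum.inr μ)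
        from rfl,
      show comp (comp G (E2 d Lc (j + 1))) G ((Lc : ℤ) • w) ((Lc : ℤ) • y) (Sum.inr ρ') (Sum.inr μ)
        = ∑' v, ∑ g : Fib d, comp G (E2 d Lc (j + 1)) ((Lc : ℤ) • w) v (Sum.inr ρ') g * G v ((Lc : ℤ) • y) g (Sum.inr μ) from rfl,
      ← tsum_mul_left]
    exact tsum_congr fun v => by rw [Finset.mul_sum]; exact Finset.sum_congr rfl fun g _ => by ring
  simp only [colM]
  rw [hlin] at hkkt
  field_simp
  linarith

/-- [folklore] **THE MULTIPLIER-COLUMN VERTEX OF THE SANDWICH**: `vertexOfM (G∘E2 (j+1)∘G) Lc Q μ y = −(wVH (j+1))⁻¹ • vertexOfM G Lc Q μ y`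
for every table `Q` read summably (bounded entries). -/
theorem vertexOfM_sandwich_E2 (hr : r ∈ box (d + 1) Lc) (j : ℕ) {Q : Fin (d + 1) → (Fin (d + 1) → ℤ) → MKer (d + 1) (Fib d)}
    (μ : Fin (d + 1)) (y : Fin (d + 1) → ℤ) :
    vertexOfM (comp (comp (coDressKBmAt (toSite r) Lc (KInvStep (d := d) Lc (j + 1))) (E2 d Lc (j + 1)))
        (coDressKBmAt (toSite r) Lc (KInvStep (d := d) Lc (j + 1)))) Lc Q μ y
      = -((wVH d Lc (j + 1))⁻¹ • vertexOfM (coDressKBmAt (toSite r) Lc (KInvStep (d := d) Lc (j + 1))) Lc Q μ y) := by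
  funext x z a b
  simp only [vertexOfM, cwsum_apply, Pi.neg_apply, Pi.smul_apply, smul_eq_mul, Finset.mul_sum, ← Finset.sum_neg_distrib]
  refine Finset.sum_congr rfl fun ρ' _ => ?_
  rw [← tsum_mul_left, ← tsum_neg]
  refine tsum_congr fun w => ?_
  rw [colM_sandwich_E2 hr j μ y ρ' w]
  ring

/-- [folklore] **THE Λ-FOLD OF THE WALL'S STEP PROPAGATOR, TYPED THROUGH `G_{j+1}`, IS THE MULTIPLIER-COLUMN VERTEX** (with part 1):
`vertexOfK G Lc (κ u ↦ c • SLam Lc (lamCoeffK G (E2 (j+1)) Lc) Q κ u) μ y = (c / wVH (j+1)) • vertexOfM G Lc Q μ y` for `G = G_{j+1}` and every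
bounded coarse-bond table `Q` — weight `c / wVH (j+1)`, sign PLUS. -/
theorem vertexOfK_lagrangePiece_eq_vertexOfM (hr : r ∈ box (d + 1) Lc) (j : ℕ)
    {Q : Fin (d + 1) → (Fin (d + 1) → ℤ) → MKer (d + 1) (Fib d)} {B : ℝ} (hQ : ∀ ρ' w x z a b, |Q ρ' w x z a b| ≤ B) (c : ℝ)
    (μ : Fin (d + 1)) (y : Fin (d + 1) → ℤ) :
    vertexOfK (coDressKBmAt (toSite r) Lc (KInvStep (d := d) Lc (j + 1))) Lc
        (fun κ u => c • SLam Lc (lamCoeffK (coDressKBmAt (toSite r) Lc (KInvStep (d := d) Lc (j + 1))) (E2 d Lc (j + 1)) Lc) Q κ u) μ y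
      = (c / wVH d Lc (j + 1)) • vertexOfM (coDressKBmAt (toSite r) Lc (KInvStep (d := d) Lc (j + 1))) Lc Q μ y := by
  have hG := decays_coDressKBmAt_KInvStep (d := d) hr (j + 1)
  have hAE : ∃ δ C : ℝ, 0 < δ ∧ 0 ≤ C ∧
      Decays (comp (coDressKBmAt (toSite r) Lc (KInvStep (d := d) Lc (j + 1))) (E2 d Lc (j + 1))) C δ := by
    obtain ⟨δ₁, C₁, hδ₁, hC₁, h₁⟩ := hG
    obtain ⟨δ₂, C₂, hδ₂, hC₂, h₂⟩ := decays_E2 (d := d) (Lc := Lc) (j + 1)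
    have h₁' : Decays (coDressKBmAt (toSite r) Lc (KInvStep (d := d) Lc (j + 1))) C₁ (min δ₁ δ₂) :=
      decays_mono h₁ hC₁ le_rfl (min_le_left _ _)
    have h₂' : Decays (E2 d Lc (j + 1)) C₂ (min δ₁ δ₂) := decays_mono h₂ hC₂ le_rfl (min_le_right _ _)
    have hm : 0 < min δ₁ δ₂ := lt_min hδ₁ hδ₂
    exact ⟨min δ₁ δ₂ / 2, _, half_pos hm, (decays_comp h₁' h₂' (half_pos hm).le (half_lt_self hm)).nonneg (Sum.inl 0),
      decays_comp h₁' h₂' (half_pos hm).le (half_lt_self hm)⟩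
  rw [vertexOfK_smul_SLam_lamCoeffK (N := Lc) hG hAE (fun v u h ν => E2_inr_col Lc (j + 1) v u h ν) hQ c μ y,
    vertexOfM_sandwich_E2 hr j μ y, smul_neg, neg_neg, smul_smul, div_eq_mul_inv]

/-- [folklore] **ORDER-ONE CONSISTENCY OF THE Λ-SECTOR, LITERALLY**: the Lagrange piece of the recursive first-order tables with weight
`cΛ·wΛ (j+1)`, conversion coefficients typed THROUGH `G_{j+1}`, read through the field rows of `G_{j+1}`, IS an2's multiplier-column vertex of
`M1At d Lc (toSite r) cΛ (j+1) = (cΛ·wM1 (j+1)) • hessFFAt` (given any uniform bound on the `hessFFAt` entries):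
`vertexOfK G Lc (κ u ↦ (cΛ·wΛ (j+1)) • SLam Lc (lamCoeffK G (E2 (j+1)) Lc) (hessFFAt (toSite r) Lc) κ u) μ y = vertexOfM G Lc (M1At d Lc (toSite r) cΛ (j+1)) μ y`. -/
theorem vertexOfK_lagrangePiece_eq_M1At (hr : r ∈ box (d + 1) Lc) (j : ℕ) (cΛ : ℝ) {B : ℝ}
    (hQ : ∀ ρ' w x z a b, |hessFFAt (toSite r) Lc ρ' w x z a b| ≤ B) (μ : Fin (d + 1)) (y : Fin (d + 1) → ℤ) :
    vertexOfK (coDressKBmAt (toSite r) Lc (KInvStep (d := d) Lc (j + 1))) Lc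
        (fun κ u => (cΛ * wΛ d Lc (j + 1)) •
          SLam Lc (lamCoeffK (coDressKBmAt (toSite r) Lc (KInvStep (d := d) Lc (j + 1))) (E2 d Lc (j + 1)) Lc) (hessFFAt (toSite r) Lc) κ u) μ y
      = vertexOfM (coDressKBmAt (toSite r) Lc (KInvStep (d := d) Lc (j + 1))) Lc (M1At d Lc (toSite r) cΛ (j + 1)) μ y := by
  rw [vertexOfK_lagrangePiece_eq_vertexOfM hr j hQ _ μ y]
  have hw : wVH d Lc (j + 1) ≠ 0 := wVH_ne_zero (j + 1)
  have hc : cΛ * wΛ d Lc (j + 1) / wVH d Lc (j + 1) = cΛ * wM1 d Lc (j + 1) := by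
    rw [wΛ_eq_wM1_mul_wVH]; field_simp
  rw [hc]
  funext x z a b
  simp only [Pi.smul_apply, smul_eq_mul, vertexOfM, cwsum_apply, M1At, Finset.mul_sum]
  refine Finset.sum_congr rfl fun ρ' _ => ?_
  rw [← tsum_mul_left]
  exact tsum_congr fun w => by ring

end Wall

end Summit.QuantumFields.BalabanUV.Beta.LagrangeFoldStep

end
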